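import Literature.Analysis.Complex.HorizontalStripResidues
import Mathlib.Analysis.SpecialFunctions.Gaussian.FourierTransform
import Mathlib.Analysis.SpecialFunctions.Gaussian.GaussianIntegral
import Mathlib.Analysis.SpecialFunctions.Trigonometric.Bounds
import Mathlib.Analysis.SpecialFunctions.Trigonometric.DerivHyp
import Mathlib.Analysis.SpecialFunctions.Pow.Real
import Mathlib.Analysis.Real.Pi.Bounds
import HarnessLib

/-!
# Riemann's integral `∫ e^{πix²+2πiwx}/(e^{πix} − e^{−πix}) dx` along a line of slope one (Siegel 1932, §1)

Topic `Literature/NumberTheory/LFunctions`. First file of a proof of the Riemann–Siegel integral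
formula (Siegel 1932, §3; Titchmarsh, *The Theory of the Riemann Zeta-Function*, §2.10) and of
Lehman's bound `|ζ(½+it)| ≤ 4(t/2π)^{1/4}` (`Literature.NumberTheory.LFunctions.Trudgian2011_lemma_2_5`).
All integrals of that theory are taken along straight lines of slope `±1`; here we set up the
lines of slope `+1`, `x = c + u(1+i)` (`Literature.NumberTheory.LFunctions.SiegelIntegral.line`), the
Gaussian majorants of the kernels `A(x) e^{πix² + bx}/sin(πx)` on them (integrability along a line,
uniform decay on the cross-sections, as required by the residue theorem
`Literature.Analysis.Complex.integral_slant_div_sin_sub_eq_sum`), and we evaluate Riemann's integral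
(Siegel 1932, §1, eq. (5), there written for the mirror-image lines of slope `−1`; Titchmarsh
(2.10.4)–(2.10.5); the integral was studied in general by Mordell 1933):

* `Literature.NumberTheory.LFunctions.SiegelIntegral.mordellPsi c w = (1+i) ∫ e^{πix²+2πiwx}/(e^{πix}−e^{−πix}) du`,
  `x = c + u(1+i)` — the integral over the line of slope one through the real point `c`, traversed
  upwards (`dx = (1+i) du`);
* `Literature.NumberTheory.LFunctions.SiegelIntegral.mordellPsi_add_one` — the first difference equation
  `Ψ(w+1) − Ψ(w) = (1+i)(1/2)^{1/2} e^{−πi(w+½)²}` (a Gaussian integral, `integral_cexp_quadratic`);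
* `Literature.NumberTheory.LFunctions.SiegelIntegral.mordellPsi_half_sub_mordellPsi_neg_half` — the second,
  `Ψ_{½}(w) − Ψ_{−½}(w) = 1` (the residue `1/(2πi)` of the integrand at `x = 0`), and
  `Ψ_{−½}(w) = e^{−2πiw} Ψ_{½}(w−1)` (translation by one);
* `Literature.NumberTheory.LFunctions.SiegelIntegral.mordellPsi_eq` — **Riemann's evaluation**: for `w ∉ ℤ`,
  `Ψ_{½}(w) = 1/(1 − e^{−2πiw}) − e^{−πiw²}/(e^{πiw} − e^{−πiw})`.

Mirror conventions: Siegel integrates `e^{−πix²+2πiux}` over lines of slope `−1` ("`0↖1`"); complex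
conjugation maps his statement onto ours (`Ψ(w) = conj Φ(−w̄)`), which is the form produced directly
by the slope-one residue theorem of `HorizontalStripResidues.lean`. Everything here is proved; no
named facts.

## References

* C. L. Siegel, *Über Riemanns Nachlaß zur analytischen Zahlentheorie*, Quellen und Studien zur
  Geschichte der Math. Astr. Phys. 2 (1932), 45–80, §1 eqs. (1)–(5). [Siegel1932]
* E. C. Titchmarsh, *The Theory of the Riemann Zeta-Function*, 2nd ed., Oxford 1986, §2.10,
  (2.10.1)–(2.10.5). [Titchmarsh1986]
-/

noncomputable section

open Complex MeasureTheory Set Filter Real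
open scoped Topology

namespace Literature.NumberTheory.LFunctions

namespace SiegelIntegral

/-! ## Lines of slope one -/

/-- The point `c + u(1+i)` of the line of slope one through the real point `c`. [folklore] -/
abbrev line (c u : ℝ) : ℂ := (c : ℂ) + (u : ℂ) * (1 + I)

/-- Real part of a point of the line through `c`. [folklore] -/
@[simp] lemma line_re (c u : ℝ) : (line c u).re = c + u := by simp [line]

/-- Imaginary part of a point of the line through `c`. [folklore] -/
@[simp] lemma line_im (c u : ℝ) : (line c u).im = u := by simp [line]

/-- `line c u` as `re + im·i`. [folklore] -/
lemma line_eq (c u : ℝ) : line c u = ((c + u : ℝ) : ℂ) + (u : ℂ) * I := by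
  simp only [line]; push_cast; ring

/-- Translating the line by a real number. [folklore] -/
lemma line_add (c c' u : ℝ) : line (c + c') u = line c u + c' := by
  simp only [line]; push_cast; ring

/-- A point of the line through `c` is at distance `≥ |c|/√2` from the origin:
`‖c + u(1+i)‖² = (c+u)² + u² ≥ c²/2`. [folklore] -/
lemma sq_norm_line (c u : ℝ) : ‖line c u‖ ^ 2 = (c + u) ^ 2 + u ^ 2 := by
  rw [line_eq, Complex.sq_norm, Complex.normSq_add_mul_I]

/-- `‖line c u‖² ≥ c²/2`. [folklore] -/
lemma half_sq_le_sq_norm_line (c u : ℝ) : c ^ 2 / 2 ≤ ‖line c u‖ ^ 2 := by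
  rw [sq_norm_line]; nlinarith [sq_nonneg (c + 2 * u)]

/-- `‖line c u‖ ≤ |c| + 2|u|`. [folklore] -/
lemma norm_line_le (c u : ℝ) : ‖line c u‖ ≤ |c| + 2 * |u| := by
  calc ‖line c u‖ ≤ ‖(c : ℂ)‖ + ‖(u : ℂ) * (1 + I)‖ := norm_add_le _ _
    _ ≤ |c| + 2 * |u| := by
        rw [Complex.norm_real, norm_mul, Complex.norm_real, Real.norm_eq_abs, Real.norm_eq_abs]
        have h : ‖(1 : ℂ) + I‖ ≤ 2 := by
          calc ‖(1 : ℂ) + I‖ ≤ ‖(1 : ℂ)‖ + ‖I‖ := norm_add_le _ _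
            _ = 2 := by simp; norm_num
        nlinarith [abs_nonneg u]

/-! ## The Gaussian factor and the denominator along a line -/

/-- The real part of the quadratic phase `πix² + bx` at `x = c + u(1+i)`:
`−2πu² − 2πcu + (Re b)(c+u) − (Im b) u`. [folklore] -/
lemma re_quadPhase (b : ℂ) (c u : ℝ) :
    (π * I * (line c u) ^ 2 + b * line c u).re =
      -2 * π * u ^ 2 - 2 * π * c * u + b.re * (c + u) - b.im * u := by
  rw [line_eq]
  simp only [add_re, mul_re, mul_im, ofReal_re, ofReal_im, I_re, I_im, sq, add_im]
  ring

/-- Modulus of the Gaussian factor along a line of slope one: a real Gaussian in the parameter.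
[folklore] -/
lemma norm_cexp_quadPhase (b : ℂ) (c u : ℝ) :
    ‖cexp (π * I * (line c u) ^ 2 + b * line c u)‖ =
      Real.exp (-2 * π * u ^ 2 - 2 * π * c * u + b.re * (c + u) - b.im * u) := by
  rw [Complex.norm_exp, re_quadPhase]

/-- `‖sin(a + bi)‖² = sin² a + sinh² b` for real `a, b`. [folklore] -/
lemma sq_norm_sin_ofReal_add_mul_I (a b : ℝ) :
    ‖Complex.sin (a + b * I)‖ ^ 2 = Real.sin a ^ 2 + Real.sinh b ^ 2 := by
  rw [Complex.sin_eq]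
  have hre : ((a : ℂ) + b * I).re = a := by simp
  have him : ((a : ℂ) + b * I).im = b := by simp
  rw [hre, him, ← ofReal_sin, ← ofReal_cos, ← ofReal_sinh, ← ofReal_cosh]
  rw [show ((Real.sin a : ℂ) * (Real.cosh b : ℂ) + (Real.cos a : ℂ) * (Real.sinh b : ℂ) * I)
      = ((Real.sin a * Real.cosh b : ℝ) : ℂ) + ((Real.cos a * Real.sinh b : ℝ) : ℂ) * I by
    push_cast; ring]
  rw [Complex.sq_norm, Complex.normSq_add_mul_I]
  have h1 := Real.cosh_sq b
  have h2 := Real.sin_sq_add_cos_sq a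
  linear_combination (Real.sin a ^ 2) * h1 + (Real.sinh b ^ 2) * h2

/-- `2·|y − round y| ≤ |sin(πy)|` for real `y` (Jordan's inequality `sin x ≥ (2/π) x` on
`[0, π/2]`, applied to `π |y − round y| ≤ π/2`). [folklore] -/
lemma two_mul_abs_sub_round_le_abs_sin (y : ℝ) :
    2 * |y - round y| ≤ |Real.sin (π * y)| := by
  set n : ℤ := round y with hn
  set t : ℝ := y - n with ht
  have h1 : |t| ≤ 1 / 2 := abs_sub_round y
  have h2 : |Real.sin (π * y)| = |Real.sin (π * t)| := by
    have := Real.sin_add_int_mul_pi (π * t) n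
    rw [show π * t + ↑n * π = π * y by rw [ht]; ring] at this
    rw [this, abs_mul, abs_neg_one_zpow, one_mul]
  -- Jordan: `2|t| ≤ sin (π |t|) = |sin (π t)|`
  have hπ := Real.pi_pos
  have hj := Real.mul_le_sin (by positivity : 0 ≤ π * |t|) (by nlinarith : π * |t| ≤ π / 2)
  have h3 : 2 / π * (π * |t|) = 2 * |t| := by field_simp
  have h4 : Real.sin (π * |t|) = |Real.sin (π * t)| := by
    rcases le_or_gt 0 t with h0 | h0
    · rw [abs_of_nonneg h0, abs_of_nonneg]
      exact Real.sin_nonneg_of_nonneg_of_le_pi (by positivity) (by nlinarith [abs_of_nonneg h0])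
    · rw [abs_of_neg h0, mul_neg, Real.sin_neg, abs_of_nonpos]
      have : π * t ≤ 0 := by nlinarith
      exact Real.sin_nonpos_of_nonpos_of_neg_pi_le this (by nlinarith [abs_of_neg h0])
  rw [h2, ← h4]
  linarith

/-- **The denominator stays away from zero along a line avoiding the integers.** If `d ≤ |c − n|`
for every integer `n`, then `‖sin(π(c + u(1+i)))‖ ≥ d` for all real `u`
(`‖sin‖² = sin²(π(c+u)) + sinh²(πu)`; for `|u| ≥ d/2` the `sinh` term, else the `sin` term, is
`≥ d`). [folklore] -/
lemma le_norm_sin_pi_line {c d : ℝ} (hd : ∀ n : ℤ, d ≤ |c - n|) (u : ℝ) :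
    d ≤ ‖Complex.sin (π * line c u)‖ := by
  rcases le_or_gt d 0 with hd0 | hd0
  · exact hd0.trans (norm_nonneg _)
  have hsq : ‖Complex.sin (π * line c u)‖ ^ 2 = Real.sin (π * (c + u)) ^ 2 + Real.sinh (π * u) ^ 2 := by
    rw [show (π : ℂ) * line c u = ((π * (c + u) : ℝ) : ℂ) + ((π * u : ℝ) : ℂ) * I by
      rw [line_eq]; push_cast; ring]
    exact sq_norm_sin_ofReal_add_mul_I _ _
  have key : d ^ 2 ≤ ‖Complex.sin (π * line c u)‖ ^ 2 := by
    rw [hsq]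
    rcases le_or_gt (d / 2) |u| with hu | hu
    · -- the `sinh` term
      have h1 : π * |u| ≤ |Real.sinh (π * u)| := by
        rw [Real.abs_sinh, ← abs_of_pos Real.pi_pos, ← abs_mul, abs_of_pos Real.pi_pos]
        exact Real.self_le_sinh_iff.2 (by positivity)
      have h2 : d ≤ π * |u| := by nlinarith [Real.pi_gt_three, abs_nonneg u]
      have h3 : d ≤ |Real.sinh (π * u)| := h2.trans h1
      nlinarith [sq_abs (Real.sinh (π * u)), sq_nonneg (Real.sin (π * (c + u))), abs_nonneg (Real.sinh (π * u))]
    · -- the `sin` term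
      set m : ℤ := round (c + u)
      have h1 : 2 * |c + u - m| ≤ |Real.sin (π * (c + u))| := two_mul_abs_sub_round_le_abs_sin _
      have h2 : d ≤ |c - m| := hd m
      have h3 : |c - m| ≤ |c + u - m| + |u| := by
        have := abs_sub_le (c - m) (c + u - m) 0
        have e1 : c - ↑m - (c + u - ↑m) = -u := by ring
        simp only [e1, abs_neg, sub_zero] at this
        linarith [abs_sub_comm (c + u - m) (c - m), abs_sub_abs_le_abs_sub (c - m) (c + u - m)]
      have h4 : d ≤ |Real.sin (π * (c + u))| := by linarith
      nlinarith [sq_abs (Real.sin (π * (c + u))), sq_nonneg (Real.sinh (π * u)), abs_nonneg (Real.sin (π * (c + u)))]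
  have h := Real.sqrt_le_sqrt key
  rwa [Real.sqrt_sq hd0.le, Real.sqrt_sq (norm_nonneg _)] at h

/-- Along a line of slope one through a non-integer real point, `sin(πx) ≠ 0`. [folklore] -/
lemma sin_pi_line_ne_zero {c : ℝ} (hc : ∀ n : ℤ, (n : ℝ) ≠ c) (u : ℝ) :
    Complex.sin (π * line c u) ≠ 0 := by
  intro h0
  obtain ⟨n, hn⟩ := (Literature.Analysis.Complex.sin_pi_mul_eq_zero_iff _).1 h0
  have h1 := congrArg Complex.im hn
  have h2 := congrArg Complex.re hn
  simp only [line_im, Complex.intCast_im] at h1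
  simp only [line_re, Complex.intCast_re, h1, add_zero] at h2
  exact hc n h2.symm

/-- On a far cross-section, `‖sin(π(c + T(1+i)))‖ ≥ 1` once `|T| ≥ 1` (the `sinh` term). [folklore] -/
lemma one_le_norm_sin_pi_line {T : ℝ} (hT : 1 ≤ |T|) (c : ℝ) :
    1 ≤ ‖Complex.sin (π * line c T)‖ := by
  have hsq : ‖Complex.sin (π * line c T)‖ ^ 2 = Real.sin (π * (c + T)) ^ 2 + Real.sinh (π * T) ^ 2 := by
    rw [show (π : ℂ) * line c T = ((π * (c + T) : ℝ) : ℂ) + ((π * T : ℝ) : ℂ) * I by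
      rw [line_eq]; push_cast; ring]
    exact sq_norm_sin_ofReal_add_mul_I _ _
  have h1 : π * |T| ≤ |Real.sinh (π * T)| := by
    rw [Real.abs_sinh, ← abs_of_pos Real.pi_pos, ← abs_mul, abs_of_pos Real.pi_pos]
    exact Real.self_le_sinh_iff.2 (by positivity)
  have h2 : 1 ≤ |Real.sinh (π * T)| := by nlinarith [Real.pi_gt_three]
  have key : (1 : ℝ) ^ 2 ≤ ‖Complex.sin (π * line c T)‖ ^ 2 := by
    rw [hsq]
    nlinarith [sq_abs (Real.sinh (π * T)), sq_nonneg (Real.sin (π * (c + T))), abs_nonneg (Real.sinh (π * T))]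
  have h := Real.sqrt_le_sqrt key
  rwa [Real.sqrt_sq zero_le_one, Real.sqrt_sq (norm_nonneg _)] at h

/-! ## Gaussian majorants: integrability along a line, decay on the cross-sections -/

/-- A polynomial times an off-centred Gaussian is dominated by a centred Gaussian:
`(1+|u|)^N e^{−2πu² + βu + γ} ≤ e^{γ + (N+|β|)²/(2π)} e^{−πu²}`. [folklore] -/
lemma poly_mul_gaussian_le (N : ℕ) (β γ u : ℝ) :
    (1 + |u|) ^ N * Real.exp (-2 * π * u ^ 2 + β * u + γ) ≤
      Real.exp (γ + (N + |β|) ^ 2 / (2 * π)) * Real.exp (-π * u ^ 2) := by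
  have hπ := Real.pi_pos
  have h1 : (1 + |u|) ^ N ≤ Real.exp (N * |u|) := by
    rw [Real.exp_nat_mul]
    have : 1 + |u| ≤ Real.exp |u| := by linarith [Real.add_one_le_exp |u|]
    gcongr
  have h2 : β * u ≤ |β| * |u| := by rw [← abs_mul]; exact le_abs_self _
  set a : ℝ := N + |β| with ha
  have h3 : a * |u| ≤ π / 2 * u ^ 2 + a ^ 2 / (2 * π) := by
    have h := sq_nonneg (π * |u| - a)
    have hu2 : |u| ^ 2 = u ^ 2 := sq_abs u
    rw [show π / 2 * u ^ 2 + a ^ 2 / (2 * π) = (π ^ 2 * u ^ 2 + a ^ 2) / (2 * π) by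
      field_simp]
    rw [le_div_iff₀ (by positivity)]
    nlinarith
  calc (1 + |u|) ^ N * Real.exp (-2 * π * u ^ 2 + β * u + γ)
      ≤ Real.exp (N * |u|) * Real.exp (-2 * π * u ^ 2 + β * u + γ) :=
        mul_le_mul_of_nonneg_right h1 (Real.exp_pos _).le
    _ = Real.exp (N * |u| + (-2 * π * u ^ 2 + β * u + γ)) := by rw [← Real.exp_add]
    _ ≤ Real.exp (γ + a ^ 2 / (2 * π) + -π * u ^ 2) := by
        refine Real.exp_le_exp.2 ?_
        have : (N : ℝ) * |u| + |β| * |u| = a * |u| := by rw [ha]; ring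
        nlinarith [sq_nonneg u]
    _ = Real.exp (γ + (N + |β|) ^ 2 / (2 * π)) * Real.exp (-π * u ^ 2) := by rw [Real.exp_add]

/-- **Integrability along a line of slope one.** If `g` is continuous with polynomial growth,
`‖g u‖ ≤ C (1+|u|)^N`, and the line through `c` keeps distance `≥ d > 0` from the integers, then
`u ↦ g(u) e^{πix² + bx}/sin(πx)`, `x = c + u(1+i)`, is integrable. [folklore] -/
theorem integrable_mul_cexp_quadPhase_div_sin {g : ℝ → ℂ} (hg : Continuous g) {C : ℝ} {N : ℕ}
    (hC : ∀ u, ‖g u‖ ≤ C * (1 + |u|) ^ N) (b : ℂ) {c d : ℝ} (hd0 : 0 < d)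
    (hd : ∀ n : ℤ, d ≤ |c - n|) :
    Integrable fun u : ℝ ↦
      g u * cexp (π * I * (line c u) ^ 2 + b * line c u) / Complex.sin (π * line c u) := by
  have hC0 : 0 ≤ C := by
    have h := hC 0
    simp only [abs_zero, add_zero, one_pow, mul_one] at h
    exact (norm_nonneg _).trans h
  have hsin : ∀ u, Complex.sin (π * line c u) ≠ 0 := fun u h0 ↦ by
    have := le_norm_sin_pi_line hd u
    rw [h0, norm_zero] at this
    linarith
  have hcont : Continuous fun u : ℝ ↦
      g u * cexp (π * I * (line c u) ^ 2 + b * line c u) / Complex.sin (π * line c u) := by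
    refine (hg.mul (by fun_prop)).div (by fun_prop) hsin
  set β : ℝ := -2 * π * c + b.re - b.im with hβ
  set γ : ℝ := b.re * c with hγ
  set K : ℝ := Real.exp (γ + (N + |β|) ^ 2 / (2 * π)) with hK
  refine Integrable.mono' (((integrable_exp_neg_mul_sq Real.pi_pos).const_mul (C / d * K)))
    hcont.aestronglyMeasurable (Eventually.of_forall fun u ↦ ?_)
  rw [norm_div, norm_mul, norm_cexp_quadPhase]
  have hs := le_norm_sin_pi_line hd u
  have hexp : -2 * π * u ^ 2 - 2 * π * c * u + b.re * (c + u) - b.im * u = -2 * π * u ^ 2 + β * u + γ := by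
    rw [hβ, hγ]; ring
  rw [hexp, div_le_iff₀ (hd0.trans_le hs)]
  have hpg := poly_mul_gaussian_le N β γ u
  calc ‖g u‖ * Real.exp (-2 * π * u ^ 2 + β * u + γ)
      ≤ C * (1 + |u|) ^ N * Real.exp (-2 * π * u ^ 2 + β * u + γ) :=
        mul_le_mul_of_nonneg_right (hC u) (Real.exp_pos _).le
    _ ≤ C * (K * Real.exp (-π * u ^ 2)) := by rw [mul_assoc]; exact mul_le_mul_of_nonneg_left hpg hC0
    _ = C / d * K * Real.exp (-π * u ^ 2) * d := by field_simp
    _ ≤ C / d * K * Real.exp (-π * u ^ 2) * ‖Complex.sin (↑π * line c u)‖ := by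
        have : 0 ≤ C / d * K * Real.exp (-π * u ^ 2) := by positivity
        exact mul_le_mul_of_nonneg_left hs this

/-- **Uniform decay on the far cross-sections.** If `‖G(c + T(1+i))‖ ≤ C(1+|T|)^N` for
`c ∈ [c₁, c₂]` and `|T| ≥ 1`, then `G(x) e^{πix²+bx}/sin(πx)` at `x = c + T(1+i)` tends to `0` as
`|T| → ∞`, uniformly in `c ∈ [c₁, c₂]` (the hypothesis of the slope-one residue theorem).
[folklore] -/
theorem decay_mul_cexp_quadPhase_div_sin {G : ℂ → ℂ} {C : ℝ} {N : ℕ} {c₁ c₂ : ℝ}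
    (hC : ∀ c ∈ Icc c₁ c₂, ∀ T : ℝ, 1 ≤ |T| → ‖G (line c T)‖ ≤ C * (1 + |T|) ^ N) (b : ℂ) :
    ∀ ε : ℝ, 0 < ε → ∃ T₀ : ℝ, ∀ T : ℝ, T₀ ≤ |T| → ∀ c ∈ Icc c₁ c₂,
      ‖G (line c T) * cexp (π * I * (line c T) ^ 2 + b * line c T) / Complex.sin (π * line c T)‖
        ≤ ε := by
  intro ε hε
  -- uniform constants
  set M : ℝ := |c₁| + |c₂| with hM
  set B : ℝ := 2 * π * M + |b.re| + |b.im| with hB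
  set Γ : ℝ := |b.re| * M with hΓ
  set K : ℝ := Real.exp (Γ + (N + |B|) ^ 2 / (2 * π)) with hK
  set C' : ℝ := max C 0 with hC'
  set T₀ : ℝ := max 1 (Real.log (C' * K + 1) - Real.log ε) with hT₀
  refine ⟨T₀, fun T hT c hc ↦ ?_⟩
  have hT1 : 1 ≤ |T| := le_trans (le_max_left _ _) hT
  have hcM : |c| ≤ M := by
    rw [hM]
    rcases le_or_gt 0 c with h0 | h0
    · rw [abs_of_nonneg h0]; linarith [hc.2, le_abs_self c₂, abs_nonneg c₁]
    · rw [abs_of_neg h0]; linarith [hc.1, neg_abs_le c₁, abs_nonneg c₂]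
  rw [norm_div, norm_mul, norm_cexp_quadPhase]
  have hs := one_le_norm_sin_pi_line hT1 c
  rw [div_le_iff₀ (by linarith)]
  -- bound the exponent by `-2πT² + B|T| + Γ`
  have hexp : -2 * π * T ^ 2 - 2 * π * c * T + b.re * (c + T) - b.im * T ≤ -2 * π * T ^ 2 + B * |T| + Γ := by
    have e1 : -(2 * π * c * T) ≤ 2 * π * M * |T| := by
      have h3 : |2 * π * c * T| = 2 * π * (|c| * |T|) := by
        rw [abs_mul, abs_mul, abs_mul, abs_of_pos Real.pi_pos, abs_two]; ring
      have h2 : -(2 * π * c * T) ≤ |2 * π * c * T| := neg_le_abs _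
      have h4 : |c| * |T| ≤ M * |T| := mul_le_mul_of_nonneg_right hcM (abs_nonneg T)
      nlinarith [Real.pi_pos]
    have e2 : b.re * c ≤ |b.re| * M := by
      calc b.re * c ≤ |b.re * c| := le_abs_self _
        _ = |b.re| * |c| := abs_mul _ _
        _ ≤ |b.re| * M := by gcongr
    have e3 : b.re * T ≤ |b.re| * |T| := by rw [← abs_mul]; exact le_abs_self _
    have e4 : -(b.im * T) ≤ |b.im| * |T| := by rw [← abs_mul]; exact neg_le_abs _
    rw [hB, hΓ]; nlinarith
  have hG := hC c hc T hT1
  have hC'C : C ≤ C' := le_max_left _ _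
  have hC'0 : 0 ≤ C' := le_max_right _ _
  have hpg := poly_mul_gaussian_le N B Γ |T|
  rw [abs_abs, sq_abs] at hpg
  have hgauss : Real.exp (-π * T ^ 2) ≤ Real.exp (-|T|) := by
    refine Real.exp_le_exp.2 ?_
    have : |T| ≤ T ^ 2 := by rw [← sq_abs]; nlinarith
    nlinarith [Real.pi_gt_three, abs_nonneg T]
  have hlog : Real.exp (-|T|) ≤ ε / (C' * K + 1) := by
    have hpos : 0 < C' * K + 1 := by positivity
    have h1 : Real.log (C' * K + 1) - Real.log ε ≤ |T| := le_trans (le_max_right _ _) hT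
    have h2 : Real.exp (-|T|) ≤ Real.exp (Real.log ε - Real.log (C' * K + 1)) :=
      Real.exp_le_exp.2 (by linarith)
    rw [Real.exp_sub, Real.exp_log hε, Real.exp_log hpos] at h2
    exact h2
  calc ‖G (line c T)‖ * Real.exp (-2 * π * T ^ 2 - 2 * π * c * T + b.re * (c + T) - b.im * T)
      ≤ C' * (1 + |T|) ^ N * Real.exp (-2 * π * T ^ 2 + B * |T| + Γ) := by
        have h1 : ‖G (line c T)‖ ≤ C' * (1 + |T|) ^ N := hG.trans (by gcongr)
        have h2 := Real.exp_le_exp.2 hexp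
        exact mul_le_mul h1 h2 (Real.exp_pos _).le (by positivity)
    _ ≤ C' * (K * Real.exp (-π * T ^ 2)) := by
        rw [mul_assoc]; exact mul_le_mul_of_nonneg_left hpg hC'0
    _ ≤ C' * K * (ε / (C' * K + 1)) := by
        rw [← mul_assoc]
        exact mul_le_mul_of_nonneg_left (hgauss.trans hlog) (by positivity)
    _ ≤ ε := by
        rw [mul_div_assoc']
        rw [div_le_iff₀ (by positivity)]
        nlinarith
    _ ≤ ε * ‖Complex.sin (↑π * line c T)‖ := le_mul_of_one_le_right hε.le hs

/-! ## Riemann's integral (Mordell's integral) -/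

/-- Riemann's integrand `e^{πix² + 2πiwx}/(e^{πix} − e^{−πix})`, the denominator written as
`2i sin(πx)`. [cite: Siegel1932, §1 eq. (1)] -/
def mordellKernel (w x : ℂ) : ℂ :=
  cexp (π * I * x ^ 2 + 2 * π * I * w * x) / (2 * I * Complex.sin (π * x))

/-- `Ψ_c(w) = (1+i) ∫ e^{πix²+2πiwx}/(e^{πix}−e^{−πix}) du` over `x = c + u(1+i)`: Riemann's integral
along the line of slope one through the real point `c`, traversed upwards. (Siegel's `Φ(u)` is the
mirror image over a line of slope `−1`; `Ψ_c(w) = conj Φ(−w̄)`.) [cite: Siegel1932, §1 eq. (1)] -/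
def mordellPsi (c : ℝ) (w : ℂ) : ℂ := (1 + I) * ∫ u : ℝ, mordellKernel w (line c u)

/-- `e^{πix} − e^{−πix} = 2i sin(πx)`. [folklore] -/
lemma cexp_sub_cexp_eq_two_I_sin (x : ℂ) :
    cexp (π * I * x) - cexp (-(π * I * x)) = 2 * I * Complex.sin (π * x) := by
  rw [show (2 : ℂ) * I * Complex.sin (π * x) = I * (2 * Complex.sin (π * x)) by ring,
    Complex.two_sin, show -(↑π * x) * I = -(π * I * x) by ring,
    show ↑π * x * I = π * I * x by ring]
  linear_combination (cexp (π * I * x) - cexp (-(π * I * x))) * I_mul_I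

/-- `e^{2πix} − 1 = e^{πix}(e^{πix} − e^{−πix})`. [folklore] -/
lemma cexp_two_pi_I_mul_sub_one (x : ℂ) :
    cexp (2 * π * I * x) - 1 = cexp (π * I * x) * (2 * I * Complex.sin (π * x)) := by
  rw [← cexp_sub_cexp_eq_two_I_sin, mul_sub, ← Complex.exp_add, ← Complex.exp_add]
  rw [show π * I * x + π * I * x = 2 * π * I * x by ring, show π * I * x + -(π * I * x) = 0 by ring,
    Complex.exp_zero]

/-- The kernel in the generic shape `g · e^{πix² + bx}/sin(πx)` with `g = (2i)⁻¹`,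
`b = 2πiw`. [folklore] -/
lemma mordellKernel_eq (w x : ℂ) :
    mordellKernel w x = (2 * I)⁻¹ * cexp (π * I * x ^ 2 + (2 * π * I * w) * x) / Complex.sin (π * x) := by
  simp only [mordellKernel]
  rw [show 2 * ↑π * I * w * x = (2 * π * I * w) * x by ring]
  field_simp

/-- Integrability of Riemann's integrand along the line through a non-integer `c`. [folklore] -/
lemma integrable_mordellKernel_line (w : ℂ) {c d : ℝ} (hd0 : 0 < d) (hd : ∀ n : ℤ, d ≤ |c - n|) :
    Integrable fun u : ℝ ↦ mordellKernel w (line c u) := by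
  have h := integrable_mul_cexp_quadPhase_div_sin (g := fun _ : ℝ ↦ (2 * I)⁻¹) continuous_const
    (C := 1) (N := 0) (fun u ↦ by norm_num [norm_inv, norm_mul, Complex.norm_I]) (2 * π * I * w) hd0 hd
  refine h.congr (Eventually.of_forall fun u ↦ ?_)
  simp only [mordellKernel_eq]

/-- Half-integers are at distance `≥ 1/2` from the integers. [folklore] -/
lemma half_le_abs_half_sub_int (n : ℤ) : (1 : ℝ) / 2 ≤ |(1 / 2 : ℝ) - n| := by
  rcases le_or_gt 1 n with h | h
  · have h1 : (1 : ℝ) ≤ n := by exact_mod_cast h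
    rw [abs_of_nonpos (by linarith)]; linarith
  · have h0 : n ≤ 0 := by omega
    have h1 : (n : ℝ) ≤ 0 := by exact_mod_cast h0
    rw [abs_of_nonneg (by linarith)]; linarith

/-- `−1/2` is at distance `≥ 1/2` from the integers. [folklore] -/
lemma half_le_abs_neg_half_sub_int (n : ℤ) : (1 : ℝ) / 2 ≤ |(-1 / 2 : ℝ) - n| := by
  have h := half_le_abs_half_sub_int (n + 1)
  push_cast at h
  rwa [show (1 / 2 : ℝ) - (n + 1) = -1 / 2 - n by ring] at h

/-- No integer is the half-integer `1/2`. [folklore] -/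
lemma int_ne_half (n : ℤ) : (n : ℝ) ≠ 1 / 2 := by
  intro h
  have h1 := half_le_abs_half_sub_int n
  rw [← h, sub_self, abs_zero] at h1
  linarith

/-- No integer equals `−1/2`. [folklore] -/
lemma int_ne_neg_half (n : ℤ) : (n : ℝ) ≠ -1 / 2 := by
  intro h
  have h1 := half_le_abs_neg_half_sub_int n
  rw [← h, sub_self, abs_zero] at h1
  linarith

/-! ### First difference equation: a Gaussian integral -/

/-- Pointwise: `K_{w+1}(x) − K_w(x) = e^{πix² + 2πi(w+½)x}` wherever `sin(πx) ≠ 0`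
(`e^{2πix} − 1 = e^{πix}(e^{πix} − e^{−πix})`). [cite: Siegel1932, §1 eq. (2)] -/
lemma mordellKernel_add_one_sub (w : ℂ) {x : ℂ} (hx : Complex.sin (π * x) ≠ 0) :
    mordellKernel (w + 1) x - mordellKernel w x =
      cexp (π * I * x ^ 2 + 2 * π * I * (w + 1 / 2) * x) := by
  simp only [mordellKernel]
  have h2I : (2 : ℂ) * I * Complex.sin (π * x) ≠ 0 := mul_ne_zero (mul_ne_zero two_ne_zero I_ne_zero) hx
  rw [← sub_div, div_eq_iff h2I]
  have e1 : cexp (π * I * x ^ 2 + 2 * π * I * (w + 1) * x)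
      = cexp (π * I * x ^ 2 + 2 * π * I * w * x) * cexp (2 * π * I * x) := by
    rw [← Complex.exp_add]; ring_nf
  have e2 : cexp (π * I * x ^ 2 + 2 * π * I * (w + 1 / 2) * x)
      = cexp (π * I * x ^ 2 + 2 * π * I * w * x) * cexp (π * I * x) := by
    rw [← Complex.exp_add]; ring_nf
  rw [e1, e2, ← mul_sub_one, cexp_two_pi_I_mul_sub_one]
  ring

/-- The Gaussian integral behind the first difference equation:
`∫ e^{πix² + 2πi(w+½)x} du = (1/2)^{1/2} e^{−πi(w+½)²}` over `x = ½ + u(1+i)`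
(`integral_cexp_quadratic` with `b = −2π`, `c = 2πi(1+i)(w+1)`, `d = πi(w+¾)`). [folklore] -/
lemma integral_cexp_quadPhase_half (w : ℂ) :
    ∫ u : ℝ, cexp (π * I * (line (1 / 2) u) ^ 2 + 2 * π * I * (w + 1 / 2) * line (1 / 2) u) =
      (1 / 2 : ℂ) ^ (1 / 2 : ℂ) * cexp (-(π * I * (w + 1 / 2) ^ 2)) := by
  have hb : (-(2 * π) : ℂ).re < 0 := by
    simp only [neg_re, mul_re, re_ofNat, ofReal_re, im_ofNat, ofReal_im, mul_zero, sub_zero]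
    linarith [Real.pi_pos]
  have h := integral_cexp_quadratic hb (2 * π * I * (1 + I) * (w + 1)) (π * I * (w + 3 / 4))
  have hfun : (fun u : ℝ ↦ cexp (π * I * (line (1 / 2) u) ^ 2 + 2 * π * I * (w + 1 / 2) * line (1 / 2) u))
      = fun u : ℝ ↦ cexp (-(2 * π) * (u : ℂ) ^ 2 + 2 * π * I * (1 + I) * (w + 1) * u + π * I * (w + 3 / 4)) := by
    funext u
    congr 1
    simp only [line]
    push_cast
    linear_combination ((π : ℂ) * (u : ℂ) ^ 2 * (I + 2)) * I_sq
  rw [hfun, h]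
  have hπ : (π : ℂ) ≠ 0 := ofReal_ne_zero.2 Real.pi_ne_zero
  have hsq : (2 * π * I * (1 + I) * (w + 1)) ^ 2 = -(8 * π ^ 2) * I * (w + 1) ^ 2 := by
    linear_combination (4 * (π : ℂ) ^ 2 * (w + 1) ^ 2 * (I ^ 2 + 2 * I)) * I_sq
  congr 1
  · congr 1
    field_simp
  · congr 1
    rw [hsq]
    field_simp
    ring

/-- **First difference equation** (Siegel 1932, §1, eq. (2), mirrored):
`Ψ_{½}(w+1) − Ψ_{½}(w) = (1+i)(1/2)^{1/2} e^{−πi(w+½)²}`. [cite: Siegel1932, §1 eq. (2)] -/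
theorem mordellPsi_add_one (w : ℂ) :
    mordellPsi (1 / 2) (w + 1) - mordellPsi (1 / 2) w =
      (1 + I) * (1 / 2 : ℂ) ^ (1 / 2 : ℂ) * cexp (-(π * I * (w + 1 / 2) ^ 2)) := by
  simp only [mordellPsi]
  have hd := half_le_abs_half_sub_int
  have h1 := integrable_mordellKernel_line (w + 1) (by norm_num : (0:ℝ) < 1 / 2) hd
  have h2 := integrable_mordellKernel_line w (by norm_num : (0:ℝ) < 1 / 2) hd
  rw [← mul_sub, ← integral_sub h1 h2, mul_assoc, ← integral_cexp_quadPhase_half]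
  congr 1
  refine integral_congr_ae (Eventually.of_forall fun u ↦ ?_)
  exact mordellKernel_add_one_sub w (sin_pi_line_ne_zero int_ne_half u)

/-! ### Second difference equation: the residue at `x = 0`, and translation by one -/

/-- **Translation by one**: `Ψ_{−½}(w) = e^{−2πiw} Ψ_{½}(w − 1)`, from
`K_w(x − 1) = e^{−2πiw} K_{w−1}(x)` (`sin(π(x−1)) = −sin(πx)`, `e^{πi(x−1)²} = −e^{πix²−2πix}`).
[cite: Siegel1932, §1 eq. (4)] -/
theorem mordellPsi_neg_half (w : ℂ) :
    mordellPsi (-1 / 2) w = cexp (-(2 * π * I * w)) * mordellPsi (1 / 2) (w - 1) := by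
  suffices key : ∫ u : ℝ, mordellKernel w (line (-1 / 2) u) =
      cexp (-(2 * π * I * w)) * ∫ u : ℝ, mordellKernel (w - 1) (line (1 / 2) u) by
    simp only [mordellPsi]; rw [key]; ring
  rw [← MeasureTheory.integral_const_mul]
  refine integral_congr_ae (Eventually.of_forall fun u ↦ ?_)
  simp only
  have hx : line (-1 / 2) u = line (1 / 2) u - 1 := by
    simp only [line]; push_cast; ring
  rw [hx]
  set x : ℂ := line (1 / 2) u
  simp only [mordellKernel]
  have hsin : Complex.sin (π * (x - 1)) = -Complex.sin (π * x) := by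
    rw [mul_sub, mul_one, Complex.sin_sub_pi]
  rw [hsin]
  have hx0 : Complex.sin (π * x) ≠ 0 := sin_pi_line_ne_zero int_ne_half u
  have h2I : (2 : ℂ) * I * Complex.sin (π * x) ≠ 0 := mul_ne_zero (mul_ne_zero two_ne_zero I_ne_zero) hx0
  rw [show (2 : ℂ) * I * -Complex.sin (↑π * x) = -(2 * I * Complex.sin (π * x)) by ring, div_neg]
  have hA : cexp (π * I * (x - 1) ^ 2 + 2 * π * I * w * (x - 1))
      = -(cexp (-(2 * π * I * w)) * cexp (π * I * x ^ 2 + 2 * π * I * (w - 1) * x)) := by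
    have e : π * I * (x - 1) ^ 2 + 2 * π * I * w * (x - 1)
        = (-(2 * π * I * w) + (π * I * x ^ 2 + 2 * π * I * (w - 1) * x)) + π * I := by ring
    rw [e, Complex.exp_add, Complex.exp_add, Complex.exp_pi_mul_I]
    ring
  rw [hA, neg_div, neg_neg, mul_div_assoc]

/-- **Second difference equation** (Siegel 1932, §1, eq. (3), mirrored): the integrals over the
lines through `½` and `−½` differ by `2πi ×` the residue `1/(2πi)` of the integrand at `x = 0`:
`Ψ_{½}(w) − Ψ_{−½}(w) = 1`. [cite: Siegel1932, §1 eq. (3)] -/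
theorem mordellPsi_half_sub_mordellPsi_neg_half (w : ℂ) :
    mordellPsi (1 / 2) w - mordellPsi (-1 / 2) w = 1 := by
  simp only [mordellPsi]
  set h : ℂ → ℂ := fun x ↦ (2 * I)⁻¹ * cexp (π * I * x ^ 2 + (2 * π * I * w) * x) with hh
  have hker : ∀ x, mordellKernel w x = h x / Complex.sin (π * x) := fun x ↦ by
    rw [mordellKernel_eq]
  have hhd : Differentiable ℂ h := by
    simp only [hh]; fun_prop
  -- hypotheses of the slope-one residue theorem
  have hint : ∀ c : ℝ, (∀ n : ℤ, (1 : ℝ) / 2 ≤ |c - n|) →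
      Integrable fun u : ℝ ↦ h (line c u) / Complex.sin (π * line c u) := by
    intro c hc
    have := integrable_mordellKernel_line w (by norm_num : (0:ℝ) < 1 / 2) hc
    exact this.congr (Eventually.of_forall fun u ↦ hker _)
  have hdecay := decay_mul_cexp_quadPhase_div_sin (G := fun _ : ℂ ↦ (2 * I)⁻¹) (C := 1) (N := 0)
    (c₁ := -1 / 2) (c₂ := 1 / 2) (fun c _ T _ ↦ by norm_num [norm_inv, norm_mul, Complex.norm_I])
    (2 * π * I * w)
  have hmain := Literature.Analysis.Complex.integral_slant_div_sin_sub_eq_sum (h := h)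
    (c₁ := -1 / 2) (c₂ := 1 / 2) (by norm_num) int_ne_neg_half int_ne_half univ isOpen_univ
    (subset_univ _) hhd.differentiableOn (hint _ half_le_abs_neg_half_sub_int)
    (hint _ half_le_abs_half_sub_int) (by simpa only [hh] using hdecay)
  have hfl1 : ⌊(-1 / 2 : ℝ)⌋ = -1 := by norm_num [Int.floor_eq_iff]
  have hfl2 : ⌊(1 / 2 : ℝ)⌋ = 0 := by norm_num [Int.floor_eq_iff]
  rw [hfl1, hfl2, show Finset.Ioc (-1 : ℤ) 0 = {0} by rfl, Finset.sum_singleton] at hmain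
  simp only [zpow_zero, one_mul, Int.cast_zero, hh] at hmain
  simp only [mul_zero, zero_pow two_ne_zero, zero_add, Complex.exp_zero, mul_one] at hmain
  have hI : (1 : ℂ) + I ≠ 0 := Literature.Analysis.Complex.one_add_I_ne_zero
  rw [← mul_sub]
  simp only [hker]
  rw [hmain]
  field_simp

/-! ### Riemann's evaluation -/

/-- The constant of the first difference equation is `e^{πi/4}`:
`(1+i)(1/2)^{1/2} e^{−πi/4} = 1`. [folklore] -/
lemma one_add_I_mul_half_cpow_mul_cexp : (1 + I) * (1 / 2 : ℂ) ^ (1 / 2 : ℂ) * cexp (-(π * I / 4)) = 1 := by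
  have h1 : (1 / 2 : ℂ) ^ (1 / 2 : ℂ) = ((Real.sqrt (1 / 2) : ℝ) : ℂ) := by
    rw [Real.sqrt_eq_rpow, Complex.ofReal_cpow (by norm_num : (0:ℝ) ≤ 1 / 2)]
    push_cast
    rfl
  have h2 : cexp (-(π * I / 4)) = ((Real.sqrt 2 / 2 : ℝ) : ℂ) * (1 - I) := by
    rw [show -(↑π * I / 4) = ((-(π / 4) : ℝ) : ℂ) * I by push_cast; ring, Complex.exp_mul_I,
      ← Complex.ofReal_cos, ← Complex.ofReal_sin, Real.cos_neg, Real.sin_neg, Real.cos_pi_div_four,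
      Real.sin_pi_div_four]
    push_cast
    ring
  rw [h1, h2]
  have h3 : ((Real.sqrt (1 / 2) : ℝ) : ℂ) * ((Real.sqrt 2 / 2 : ℝ) : ℂ) = 1 / 2 := by
    rw [← Complex.ofReal_mul]
    rw [show Real.sqrt (1 / 2) * (Real.sqrt 2 / 2) = (Real.sqrt (1 / 2) * Real.sqrt 2) / 2 by ring,
      ← Real.sqrt_mul (by norm_num : (0:ℝ) ≤ 1 / 2)]
    norm_num
  calc (1 + I) * ((Real.sqrt (1 / 2) : ℝ) : ℂ) * (((Real.sqrt 2 / 2 : ℝ) : ℂ) * (1 - I))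
      = (((Real.sqrt (1 / 2) : ℝ) : ℂ) * ((Real.sqrt 2 / 2 : ℝ) : ℂ)) * ((1 + I) * (1 - I)) := by ring
    _ = 1 := by
        rw [h3]
        have : (1 + I) * (1 - I) = (2 : ℂ) := by ring_nf; rw [I_sq]; ring
        rw [this]; norm_num

/-- **Riemann's evaluation of Mordell's integral** (Siegel 1932, §1, eq. (5), mirror image;
Titchmarsh (2.10.4)): for `w ∉ ℤ`,
`(1+i) ∫ e^{πix²+2πiwx}/(e^{πix} − e^{−πix}) du = 1/(1 − e^{−2πiw}) − e^{−πiw²}/(e^{πiw} − e^{−πiw})`,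
the integral over the line `x = ½ + u(1+i)`. Proof: eliminate `Ψ(w+1)` between the two difference
equations. [cite: Siegel1932, §1 eq. (5)] -/
theorem mordellPsi_eq {w : ℂ} (hw : ∀ n : ℤ, w ≠ n) :
    mordellPsi (1 / 2) w =
      1 / (1 - cexp (-(2 * π * I * w))) - cexp (-(π * I * w ^ 2)) / (2 * I * Complex.sin (π * w)) := by
  -- the two difference equations at `w` / `w + 1`
  have hA := mordellPsi_add_one w
  have hB := mordellPsi_half_sub_mordellPsi_neg_half (w + 1)
  have hT := mordellPsi_neg_half (w + 1)
  rw [add_sub_cancel_right] at hT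
  set P := mordellPsi (1 / 2) w with hP
  set P1 := mordellPsi (1 / 2) (w + 1) with hP1
  set G : ℂ := (1 + I) * (1 / 2 : ℂ) ^ (1 / 2 : ℂ) with hG
  -- `e^{-2πi(w+1)} = e^{-2πiw}`
  have hper : cexp (-(2 * π * I * (w + 1))) = cexp (-(2 * π * I * w)) := by
    rw [show -(2 * ↑π * I * (w + 1)) = -(2 * π * I * w) + (-1 : ℤ) * (2 * π * I) by push_cast; ring,
      Complex.exp_add, Complex.exp_int_mul_two_pi_mul_I, mul_one]
  rw [hper] at hT
  set E : ℂ := cexp (-(2 * π * I * w)) with hE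
  -- `1 - E ≠ 0` and `sin(πw) ≠ 0` since `w ∉ ℤ`
  have hsin : Complex.sin (π * w) ≠ 0 := fun h0 ↦ by
    obtain ⟨n, hn⟩ := (Literature.Analysis.Complex.sin_pi_mul_eq_zero_iff w).1 h0
    exact hw n hn
  have hE1 : 1 - E ≠ 0 := by
    intro h0
    have h1 : E = 1 := by linear_combination -h0
    rw [hE, Complex.exp_eq_one_iff] at h1
    obtain ⟨n, hn⟩ := h1
    apply hw (-n)
    have hπI : (2 * π * I : ℂ) ≠ 0 := by simp [Real.pi_ne_zero, I_ne_zero]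
    have : -(2 * ↑π * I * w) = (2 * π * I) * (-w) := by ring
    rw [this, show ↑n * (2 * ↑π * I) = (2 * π * I) * n by ring] at hn
    have h2 := mul_left_cancel₀ hπI hn
    push_cast; linear_combination -h2
  -- eliminate `P1`:  P1 = P + G e^{-πi(w+1/2)²}` and `P1 = 1 + E P`
  have h1 : P1 = P + G * cexp (-(π * I * (w + 1 / 2) ^ 2)) := by
    rw [hG]; linear_combination hA
  have h2 : P1 = 1 + E * P := by linear_combination hB + hT
  have hP' : P * (1 - E) = 1 - G * cexp (-(π * I * (w + 1 / 2) ^ 2)) := by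
    linear_combination h2 - h1
  -- rewrite `G e^{-πi(w+1/2)²} = e^{-πiw²}·e^{-πiw}` and `1 - E = e^{-πiw}(e^{πiw} - e^{-πiw})`
  have hGval : G * cexp (-(π * I * (w + 1 / 2) ^ 2)) = cexp (-(π * I * w ^ 2)) * cexp (-(π * I * w)) := by
    have e : -(π * I * (w + 1 / 2) ^ 2) = -(π * I / 4) + (-(π * I * w ^ 2) + -(π * I * w)) := by ring
    rw [e, Complex.exp_add, ← mul_assoc, hG, one_add_I_mul_half_cpow_mul_cexp, one_mul, Complex.exp_add]
  have h1E : 1 - E = cexp (-(π * I * w)) * (2 * I * Complex.sin (π * w)) := by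
    rw [← cexp_sub_cexp_eq_two_I_sin, mul_sub, ← Complex.exp_add, ← Complex.exp_add, hE]
    rw [show -(↑π * I * w) + ↑π * I * w = 0 by ring, Complex.exp_zero]
    ring_nf
  have hexp0 : cexp (-(π * I * w)) ≠ 0 := Complex.exp_ne_zero _
  have hPdiv : P = (1 - cexp (-(π * I * w ^ 2)) * cexp (-(π * I * w))) / (1 - E) := by
    rw [eq_div_iff hE1, ← hGval]; exact hP'
  rw [hPdiv, sub_div]
  congr 1
  rw [h1E, mul_comm (cexp (-(↑π * I * w))) (2 * I * Complex.sin (↑π * w)),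
    mul_div_mul_right _ _ hexp0]

end SiegelIntegral

end Literature.NumberTheory.LFunctions
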